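import Literature.Topology.FourManifolds.FibrewiseMorseFramePatching
import Literature.Topology.FourManifolds.IndexOneOrthogonalPath
import Mathlib.Algebra.Order.ToIntervalMod
import HarnessLib

/-!
# Periodic adapted frames along a circle of index-one critical points

Topic `Literature/Topology/FourManifolds`, fourth file of the frame cluster
(`FibrewiseMorseFrame.lean`, `FibrewiseMorseLocalFrame.lean`, `FibrewiseMorseFramePatching.lean`).
For a `C^∞` family `g : ℝ × V → ℝ`, `T`-PERIODIC in the parameter, with nondegenerate fibre
Hessians `H(t) = ∂ᵤ∂ᵤ g (t, 0)` of Lorentzian type (index one on a `3`-space, presented by a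
Lorentz frame of `H(0) = c B`), the interval frames of `Splitting.exists_adaptedFrame_Icc` close
up to a **`T`-periodic `C^∞` adapted frame** as soon as the family is *time-orientable along the
circle*: there is a continuous `T`-periodic field `w` of `H(t)`-timelike vectors
(`Splitting.exists_periodic_adaptedFrame_of_timelike`).  This is the frame input of the periodic
fibrewise Morse lemma `Splitting.exists_periodic_fibrewiseMorseCoords_of_frame`, i.e. of the
Morse–Bott lemma along an (untwisted) circle of critical points of transverse index one
(Banyaga–Hurtubise 2004, Thm. 2; Hirsch, *Differential Topology*, Ch. 6 §1).

Proof.  A frame `Fr` on a neighbourhood of `[0, T]` with `Fr 0 = 1` (interval frames) and its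
translate `Fr T ∘ Fr (· - T)` are glued near `T` (`exists_adaptedFrame_extend_const`); the glued
frame satisfies `Fr' (s + T) = R' ∘ Fr' s` near `s = 0` for a FIXED monodromy `R' ∈ O(H(0))`.
`det R' > 0` by continuity along `t ↦ Fr' t`, and `R'` preserves the timecones because the
timelike vector `Fr' t (w t)` cannot change timecone along `[0, T]` (O'Neill, Ch. 5, Lemma 29);
so `R'` is joined to `1` inside `O(H(0))` by the path `P` of
`IndexOneForm.exists_smooth_path_of_timeconePreserving`, and `P(χ t)⁻¹ ∘ Fr' t` (with `χ ≤ 0`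
near `0`, `χ ≥ 1` near `T`) is `T`-periodic near `0`, hence extends periodically
(`contDiff_comp_toIcoMod`).

* `Splitting.contDiff_comp_toIcoMod` — smooth periodic extension of a function given on
  `(-δ, T + δ)` and `T`-periodic on `(-δ, δ)`.
* `Splitting.fderiv_fderiv_apply_add_of_periodic` — the fibre Hessians of a periodic family are
  periodic.
* `Splitting.lorentz_pairing_sign`, `Splitting.neg_of_timeconePreserving` — O'Neill's timecone
  lemma in a Lorentz frame, and its consequence for isometries.
* `Splitting.exists_periodic_adaptedFrame_of_timelike` — **main result**.

Everything here is **proved**; no definition, no named fact.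

## References

* A. Banyaga, D. E. Hurtubise, *A proof of the Morse–Bott Lemma*, Expo. Math. 22 (2004),
  365–373, Thm. 2. [BanyagaHurtubise2004]
* M. W. Hirsch, *Differential Topology*, GTM 33 (1976), Ch. 6 §1. [HirschDT1976]
* B. O'Neill, *Semi-Riemannian Geometry*, Academic Press (1983), Ch. 5, Lemma 29; Ch. 9,
  Lemma 6 and Cor. 7. [ONeill1983]
-/

noncomputable section

set_option maxSynthPendingDepth 2

open Set Function Filter Metric
open scoped Topology ContDiff

namespace Literature.Topology.FourManifolds

namespace Splitting

variable {V : Type*} [NormedAddCommGroup V] [NormedSpace ℝ V]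

/-! ### Smooth periodic extension -/

/-- **Smooth periodic extension.**  If `F` is `C^∞` on an open set containing `(-δ, T + δ)`
(`0 < δ ≤ T`) and `F (s + T) = F s` for `s ∈ (-δ, δ)`, then `t ↦ F (t mod T)` (reduction to
`[0, T)`, Mathlib's `toIcoMod`) is `C^∞` on `ℝ`. [folklore] -/
theorem contDiff_comp_toIcoMod {E : Type*} [NormedAddCommGroup E] [NormedSpace ℝ E]
    {F : ℝ → E} {T δ : ℝ} (hT : 0 < T) (hδ : 0 < δ) (hδT : δ ≤ T) {U : Set ℝ} (hU : IsOpen U)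
    (hsub : Ioo (-δ) (T + δ) ⊆ U) (hF : ContDiffOn ℝ ∞ F U)
    (hper : ∀ s ∈ Ioo (-δ) δ, F (s + T) = F s) :
    ContDiff ℝ ∞ fun t => F (toIcoMod hT 0 t) := by
  rw [contDiff_iff_contDiffAt]
  intro t₀
  obtain ⟨k, hk⟩ : ∃ k : ℤ, toIcoMod hT 0 t₀ = t₀ - k * T :=
    ⟨toIcoDiv hT 0 t₀, by rw [toIcoMod, zsmul_eq_mul]⟩
  have hm : t₀ - k * T ∈ Ico 0 T := by
    have h := toIcoMod_mem_Ico' hT t₀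
    rwa [hk] at h
  -- the smooth local model `t ↦ F (t - k T)`
  have hmodel : ∀ t, t - k * T ∈ U → ContDiffAt ℝ ∞ (fun t => F (t - k * T)) t := fun t ht =>
    (hF.contDiffAt (hU.mem_nhds ht)).comp t (contDiffAt_id.sub contDiffAt_const)
  -- `toIcoMod` near `t₀`
  have hIco : ∀ t, t - k * T ∈ Ico 0 T → toIcoMod hT 0 t = t - k * T := fun t ht =>
    (toIcoMod_eq_iff hT).2 ⟨by simpa [zero_add] using ht, k, by rw [zsmul_eq_mul]; ring⟩
  have hIco' : ∀ t, t - k * T + T ∈ Ico 0 T → toIcoMod hT 0 t = t - k * T + T := fun t ht =>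
    (toIcoMod_eq_iff hT).2 ⟨by simpa [zero_add] using ht, k - 1, by
      rw [zsmul_eq_mul]; push_cast; ring⟩
  rcases hm.1.eq_or_lt with h0 | hpos
  · -- `t₀ = k T`: near `t₀` the function is `F (t - k T)`, by the overlap relation on the left
    have hU₀ : t₀ - k * T ∈ U := hsub ⟨by rw [← h0]; linarith, by rw [← h0]; linarith⟩
    refine (hmodel t₀ hU₀).congr_of_eventuallyEq ?_
    filter_upwards [Ioo_mem_nhds (show t₀ - δ < t₀ by linarith) (show t₀ < t₀ + δ by linarith)]
      with t ht
    rcases le_or_gt t₀ t with htt | htt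
    · show F (toIcoMod hT 0 t) = F (t - k * T)
      rw [hIco t ⟨by linarith, by linarith [ht.2]⟩]
    · show F (toIcoMod hT 0 t) = F (t - k * T)
      rw [hIco' t ⟨by linarith [ht.1], by linarith⟩]
      exact hper (t - k * T) ⟨by linarith [ht.1], by linarith⟩
  · -- `toIcoMod t₀ ∈ (0, T)`: near `t₀`, `toIcoMod t = t - k T`
    have hU₀ : t₀ - k * T ∈ U := hsub ⟨by linarith, by linarith [hm.2]⟩
    refine (hmodel t₀ hU₀).congr_of_eventuallyEq ?_
    have hr₁ : min (t₀ - k * T) (T - (t₀ - k * T)) ≤ t₀ - k * T := min_le_left _ _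
    have hr₂ : min (t₀ - k * T) (T - (t₀ - k * T)) ≤ T - (t₀ - k * T) := min_le_right _ _
    have hr : 0 < min (t₀ - k * T) (T - (t₀ - k * T)) := lt_min hpos (by linarith [hm.2])
    filter_upwards [Ioo_mem_nhds (show t₀ - min (t₀ - k * T) (T - (t₀ - k * T)) < t₀ by linarith)
      (show t₀ < t₀ + min (t₀ - k * T) (T - (t₀ - k * T)) by linarith)] with t ht
    show F (toIcoMod hT 0 t) = F (t - k * T)
    rw [hIco t ⟨by linarith [ht.1], by linarith [ht.2]⟩]

/-! ### Periodicity of the fibre Hessians -/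

omit [NormedSpace ℝ V] in
/-- The fibre Hessians of a `T`-periodic family are `T`-periodic. [folklore] -/
theorem fderiv_fderiv_apply_add_of_periodic [NormedSpace ℝ V] {g : ℝ × V → ℝ} {T : ℝ}
    (hgT : ∀ (t : ℝ) (u : V), g (t + T, u) = g (t, u)) (t : ℝ) :
    fderiv ℝ (fderiv ℝ g) (t + T, 0) = fderiv ℝ (fderiv ℝ g) (t, 0) := by
  have hper : ∀ q : ℝ × V, g (q + (T, 0)) = g q := fun q => by
    obtain ⟨s, u⟩ := q
    show g (s + T, u + 0) = g (s, u)
    rw [add_zero, hgT]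
  have h1 : ∀ q : ℝ × V, fderiv ℝ g (q + (T, 0)) = fderiv ℝ g q := fun q => by
    rw [← fderiv_comp_add_right (T, (0 : V)), show (fun x => g (x + (T, 0))) = g from funext hper]
  have h2 : fderiv ℝ (fderiv ℝ g) ((t, (0 : V)) + (T, 0)) = fderiv ℝ (fderiv ℝ g) (t, 0) := by
    rw [← fderiv_comp_add_right (T, (0 : V)),
      show (fun x => fderiv ℝ g (x + (T, 0))) = fderiv ℝ g from funext h1]
  rwa [Prod.mk_add_mk, add_zero] at h2

/-! ### Timecones in a Lorentz frame -/

/-- **O'Neill's timecone lemma in coordinates.**  For timelike `x = (x₀, x₁, x₂)`,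
`y = (y₀, y₁, y₂)` (`-x₀² + x₁² + x₂² < 0`, same for `y`) the Lorentz pairing
`-x₀ y₀ + x₁ y₁ + x₂ y₂` has the sign of `-x₀ y₀` (Schwarz inequality in the spacelike
plane). [cite: ONeill1983, Ch. 5, Lemma 29] -/
theorem lorentz_pairing_sign {x₀ x₁ x₂ y₀ y₁ y₂ : ℝ} (hx : -(x₀ * x₀) + x₁ * x₁ + x₂ * x₂ < 0)
    (hy : -(y₀ * y₀) + y₁ * y₁ + y₂ * y₂ < 0) :
    (-(x₀ * y₀) + x₁ * y₁ + x₂ * y₂) * (x₀ * y₀) < 0 := by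
  have hcs : (x₁ * y₁ + x₂ * y₂) ^ 2 ≤ (x₁ ^ 2 + x₂ ^ 2) * (y₁ ^ 2 + y₂ ^ 2) := by
    nlinarith [sq_nonneg (x₁ * y₂ - x₂ * y₁)]
  have h1 : x₁ ^ 2 + x₂ ^ 2 < x₀ ^ 2 := by nlinarith
  have h2 : y₁ ^ 2 + y₂ ^ 2 < y₀ ^ 2 := by nlinarith
  have h3 : (x₁ ^ 2 + x₂ ^ 2) * (y₁ ^ 2 + y₂ ^ 2) < x₀ ^ 2 * y₀ ^ 2 :=
    mul_lt_mul'' h1 h2 (by positivity) (by positivity)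
  have hS : (x₁ * y₁ + x₂ * y₂) ^ 2 < (x₀ * y₀) ^ 2 := by nlinarith
  have habs : |x₁ * y₁ + x₂ * y₂| < |x₀ * y₀| := sq_lt_sq.1 hS
  have hP : 0 < |x₀ * y₀| := (abs_nonneg _).trans_lt habs
  have key : (x₁ * y₁ + x₂ * y₂) * (x₀ * y₀) < (x₀ * y₀) * (x₀ * y₀) :=
    calc (x₁ * y₁ + x₂ * y₂) * (x₀ * y₀) ≤ |(x₁ * y₁ + x₂ * y₂) * (x₀ * y₀)| := le_abs_self _
      _ = |x₁ * y₁ + x₂ * y₂| * |x₀ * y₀| := abs_mul _ _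
      _ < |x₀ * y₀| * |x₀ * y₀| := mul_lt_mul_of_pos_right habs hP
      _ = (x₀ * y₀) * (x₀ * y₀) := abs_mul_abs_self _
  nlinarith [key]

/-- **An isometry preserving the timecone of one timelike vector preserves all timecones.**
In a Lorentz frame `(v₀, b₁, b₂)` of the symmetric form `B`: if `R ∈ O(B)` and for SOME
`B`-timelike `x` the time coordinates `B(v₀, R x)`, `B(v₀, x)` have the same sign, then
`B (R v₀, v₀) < 0`, i.e. `R v₀` lies in the timecone of `v₀`.
[cite: ONeill1983, Ch. 5, Lemma 29] -/
theorem neg_of_timeconePreserving {B : V →L[ℝ] V →L[ℝ] ℝ} (hB : ∀ x y, B x y = B y x)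
    {v₀ b₁ b₂ : V} (hv : B v₀ v₀ = -1)
    (hexp : ∀ x, x = (-B v₀ x) • v₀ + B b₁ x • b₁ + B b₂ x • b₂) {R : V →L[ℝ] V}
    (hRO : ∀ x y, B (R x) (R y) = B x y) {x : V} (hx : B x x < 0)
    (hRx : 0 < B v₀ (R x) * B v₀ x) : B (R v₀) v₀ < 0 := by
  -- timelike vectors `R x`, `R v₀`
  have hRxx : B (R x) (R x) < 0 := by rw [hRO]; exact hx
  have hRvv : B (R v₀) (R v₀) < 0 := by rw [hRO, hv]; norm_num
  rw [IndexOneForm.apply_eq_of_frame hexp (R x) (R x)] at hRxx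
  rw [IndexOneForm.apply_eq_of_frame hexp (R v₀) (R v₀)] at hRvv
  have key := lorentz_pairing_sign hRxx hRvv
  rw [← IndexOneForm.apply_eq_of_frame hexp (R x) (R v₀), hRO, hB x v₀] at key
  -- `key : B v₀ x * (B v₀ (R x) * B v₀ (R v₀)) < 0`
  have h1 : 0 < B v₀ x * B v₀ (R x) := by rw [mul_comm]; exact hRx
  have h2 : B v₀ x * B v₀ (R x) * B v₀ (R v₀) < 0 := by rw [mul_assoc]; exact key
  have h3 : B v₀ (R v₀) < 0 := neg_of_mul_neg_right h2 h1.le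
  rwa [hB] at h3

/-! ### Periodic frames -/

/-- **Periodic adapted frames along a time-orientable circle of index-one critical points.**
Let `g : ℝ × V → ℝ` be `C^∞` and `T`-periodic in `t` (`V` finite-dimensional), with
nondegenerate fibre Hessians `H(t) = ∂ᵤ∂ᵤ g (t, 0)`; suppose `H(0) = c B` (`c > 0`) for a
symmetric form `B` presented by a Lorentz frame `(v₀, b₁, b₂)` (so `dim V = 3`, index one), and
that there is a continuous `T`-periodic field `w` of `H(t)`-timelike vectors
(`H(t) (w t, w t) < 0`).  Then there are `C^∞`, `T`-periodic, mutually inverse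
`Fr, Frinv : ℝ → (V →L V)` with `H(t) (a, b) = c B (Fr t a, Fr t b)` for all `t`.
See the module docstring for the proof. [cite: BanyagaHurtubise2004, Thm. 2]
[cite: HirschDT1976, Ch. 6 §1] [cite: ONeill1983, Ch. 5, Lemma 29; Ch. 9, Lemma 6] -/
theorem exists_periodic_adaptedFrame_of_timelike [FiniteDimensional ℝ V] {g : ℝ × V → ℝ}
    (hg : ContDiff ℝ ∞ g) {T : ℝ} (hT : 0 < T) (hgT : ∀ (t : ℝ) (u : V), g (t + T, u) = g (t, u))
    (hH : ∀ (t : ℝ) (a : V),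
      (∀ b, fderiv ℝ (fderiv ℝ g) (t, 0) ((0 : ℝ), a) ((0 : ℝ), b) = 0) → a = 0)
    {B : V →L[ℝ] V →L[ℝ] ℝ} (hB : ∀ x y, B x y = B y x) {c : ℝ} (hc : 0 < c)
    (hHB : ∀ a b : V,
      fderiv ℝ (fderiv ℝ g) ((0 : ℝ), (0 : V)) ((0 : ℝ), a) ((0 : ℝ), b) = c * B a b)
    {v₀ b₁ b₂ : V} (hv : B v₀ v₀ = -1) (h1 : B b₁ b₁ = 1) (h2 : B b₂ b₂ = 1) (h01 : B v₀ b₁ = 0)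
    (h02 : B v₀ b₂ = 0) (h12 : B b₁ b₂ = 0)
    (hexp : ∀ x, x = (-B v₀ x) • v₀ + B b₁ x • b₁ + B b₂ x • b₂)
    {w : ℝ → V} (hw : Continuous w) (hwT : ∀ t, w (t + T) = w t)
    (hwneg : ∀ t, fderiv ℝ (fderiv ℝ g) (t, 0) ((0 : ℝ), w t) ((0 : ℝ), w t) < 0) :
    ∃ Fr Frinv : ℝ → (V →L[ℝ] V), ContDiff ℝ ∞ Fr ∧ ContDiff ℝ ∞ Frinv ∧
      (∀ t, Fr (t + T) = Fr t) ∧ (∀ t, Frinv (t + T) = Frinv t) ∧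
      (∀ (t : ℝ) (a : V), Fr t (Frinv t a) = a) ∧ (∀ (t : ℝ) (a : V), Frinv t (Fr t a) = a) ∧
      ∀ (t : ℝ) (a b : V), fderiv ℝ (fderiv ℝ g) (t, 0) ((0 : ℝ), a) ((0 : ℝ), b) =
        c * B (Fr t a) (Fr t b) := by
  -- the Hessian family
  obtain ⟨H, hHap⟩ : ∃ H : ℝ → V →L[ℝ] V →L[ℝ] ℝ, ∀ (t : ℝ) (a b : V),
      H t a b = fderiv ℝ (fderiv ℝ g) (t, 0) ((0 : ℝ), a) ((0 : ℝ), b) :=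
    ⟨fun t => (fderiv ℝ (fderiv ℝ g) (t, 0)).bilinearComp (ContinuousLinearMap.inr ℝ ℝ V)
      (ContinuousLinearMap.inr ℝ ℝ V), fun t a b => by simp⟩
  have hHT : ∀ t, H (t + T) = H t := fun t => by
    ext a b
    rw [hHap, hHap, fderiv_fderiv_apply_add_of_periodic hgT]
  have hHzsmul : ∀ (n : ℤ) (t : ℝ), H (t + n • T) = H t := by
    intro n
    induction n using Int.induction_on with
    | zero => intro t; rw [zero_zsmul, add_zero]
    | succ n ih => intro t; rw [add_zsmul, one_zsmul, ← add_assoc, hHT, ih]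
    | pred n ih =>
      intro t
      have h := hHT (t + (-(n : ℤ) - 1) • T)
      rw [add_assoc, ← add_one_zsmul, sub_add_cancel] at h
      rw [← h, ih]
  have hHmod : ∀ t, H (toIcoMod hT 0 t) = H t := fun t => by
    rw [toIcoMod, sub_eq_add_neg, ← neg_zsmul, hHzsmul]
  have hH0 : ∀ a b, H 0 a b = c * B a b := fun a b => by rw [hHap]; exact hHB a b
  have hwneg' : ∀ t, H t (w t) (w t) < 0 := fun t => by rw [hHap]; exact hwneg t
  -- Step 1: an adapted frame on a neighbourhood of `[0, T]`
  obtain ⟨U, Fr, Frinv, hU, hsub, hFr, hFrinv, hFr0, hri, hli, had⟩ :=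
    exists_adaptedFrame_Icc hg hH hT.le
  have had' : ∀ t ∈ U, ∀ a b, H t a b = H 0 (Fr t a) (Fr t b) := fun t ht a b => by
    rw [hHap, hHap]
    exact had t ht a b
  have h0U : (0 : ℝ) ∈ U := hsub ⟨le_rfl, hT.le⟩
  have hTU : T ∈ U := hsub ⟨hT.le, le_rfl⟩
  -- Step 2: a uniform thickening `(-ε₀, T + ε₀) ⊆ U`
  obtain ⟨ε₀, hε₀, hthick⟩ : ∃ ε₀ > 0, Ioo (-ε₀) (T + ε₀) ⊆ U := by
    obtain ⟨ε₁, hε₁, hb₁⟩ := Metric.isOpen_iff.1 hU 0 h0U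
    obtain ⟨ε₂, hε₂, hb₂⟩ := Metric.isOpen_iff.1 hU T hTU
    rw [Real.ball_eq_Ioo] at hb₁ hb₂
    refine ⟨min ε₁ ε₂, lt_min hε₁ hε₂, fun t ht => ?_⟩
    have hm₁ := min_le_left ε₁ ε₂
    have hm₂ := min_le_right ε₁ ε₂
    rcases lt_or_ge t 0 with h | h
    · exact hb₁ ⟨by linarith [ht.1], by linarith⟩
    rcases le_or_gt t T with h' | h'
    · exact hsub ⟨h, h'⟩
    · exact hb₂ ⟨by linarith, by linarith [ht.2]⟩
  -- the gluing scale `η`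
  obtain ⟨η, hη, hηε, hηT⟩ : ∃ η : ℝ, 0 < η ∧ 4 * η ≤ ε₀ ∧ 4 * η ≤ T :=
    ⟨min ε₀ T / 4, by positivity, by linarith [min_le_left ε₀ T], by linarith [min_le_right ε₀ T]⟩
  -- Step 3: the monodromy `R = Fr T ∈ O(H 0)` and the translated frame `Fr T ∘ Fr (t - T)`
  have hRO0 : ∀ a b, H 0 (Fr T a) (Fr T b) = H 0 a b := fun a b => by
    rw [← had' T hTU, ← hHT 0, zero_add]
  have hU₁ : IsOpen ((fun t : ℝ => t - T) ⁻¹' U) :=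
    hU.preimage (continuous_id.sub continuous_const)
  have hmaps : MapsTo (fun t : ℝ => t - T) ((fun t : ℝ => t - T) ⁻¹' U) U := fun t ht => ht
  have hFr₁ :
      ContDiffOn ℝ ∞ (fun t => (Fr T).comp (Fr (t - T))) ((fun t : ℝ => t - T) ⁻¹' U) :=
    contDiffOn_const.clm_comp (hFr.comp (contDiff_id.sub contDiff_const).contDiffOn hmaps)
  have hFrinv₁ : ContDiffOn ℝ ∞ (fun t => (Frinv (t - T)).comp (Frinv T))
      ((fun t : ℝ => t - T) ⁻¹' U) :=
    (hFrinv.comp (contDiff_id.sub contDiff_const).contDiffOn hmaps).clm_comp contDiffOn_const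
  have hri₁ : ∀ t ∈ (fun t : ℝ => t - T) ⁻¹' U, ∀ a : V,
      (Fr T).comp (Fr (t - T)) (((Frinv (t - T)).comp (Frinv T)) a) = a := fun t ht a => by
    simp only [ContinuousLinearMap.comp_apply, hri (t - T) ht, hri T hTU]
  have hli₁ : ∀ t ∈ (fun t : ℝ => t - T) ⁻¹' U, ∀ a : V,
      (Frinv (t - T)).comp (Frinv T) (((Fr T).comp (Fr (t - T))) a) = a := fun t ht a => by
    simp only [ContinuousLinearMap.comp_apply, hli T hTU, hli (t - T) ht]
  have had₁ : ∀ t ∈ (fun t : ℝ => t - T) ⁻¹' U, ∀ a b : V,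
      H t a b = H 0 ((Fr T).comp (Fr (t - T)) a) ((Fr T).comp (Fr (t - T)) b) := fun t ht a b => by
    simp only [ContinuousLinearMap.comp_apply]
    rw [hRO0, ← had' (t - T) ht, ← hHT (t - T), sub_add_cancel]
  -- Step 4: glue near `T` (overlap `[T - 3η, T - η]`, junction at `T - 2η`)
  have hsub' : Icc (T - 3 * η) (T - η) ⊆ U ∩ (fun t : ℝ => t - T) ⁻¹' U := fun t ht =>
    ⟨hthick ⟨by linarith [ht.1], by linarith [ht.2]⟩,
      hthick ⟨by show -ε₀ < t - T; linarith [ht.1], by show t - T < T + ε₀; linarith [ht.2]⟩⟩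
  obtain ⟨Fr', Frinv', Cst, Cstinv, hFr's, hFrinv's, hri', hli', had'', hleft, hleft', hCstO, hCC,
      hCC', hright, hright'⟩ :=
    exists_adaptedFrame_extend_const hU hFr hFrinv hri hli had' hU₁ hFr₁ hFrinv₁ hri₁ hli₁ had₁
      (show T - 3 * η < T - 2 * η by linarith) (show T - 2 * η < T - η by linarith) hsub'
  -- the glued domain contains `(-η, T + η)`
  have hdom : Ioo (-η) (T + η) ⊆
      (U ∩ Iio (T - 2 * η)) ∪ ((fun t : ℝ => t - T) ⁻¹' U ∩ Ioi (T - 3 * η)) := fun t ht => by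
    rcases lt_or_ge t (T - 2 * η) with h | h
    · exact Or.inl ⟨hthick ⟨by linarith [ht.1], by linarith⟩, h⟩
    · exact Or.inr ⟨hthick ⟨by show -ε₀ < t - T; linarith,
        by show t - T < T + ε₀; linarith [ht.2]⟩, show T - 3 * η < t by linarith⟩
  -- Step 5: the monodromy `R' = Cst ∘ Fr T` of the glued frame: `Fr' (s + T) = R' ∘ Fr' s` near 0
  have hrel : ∀ s ∈ Ioo (-η) η, ∀ a : V, Fr' (s + T) a = Cst (Fr T (Fr' s a)) := fun s hs a => by
    rw [hright (s + T) (by linarith [hs.1]), hleft s (by linarith [hs.2])]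
    simp only [ContinuousLinearMap.comp_apply, add_sub_cancel_right]
  have hrel' : ∀ s ∈ Ioo (-η) η, ∀ a : V,
      Frinv' (s + T) a = Frinv' s (Frinv T (Cstinv a)) := fun s hs a => by
    rw [hright' (s + T) (by linarith [hs.1]), hleft' s (by linarith [hs.2])]
    simp only [ContinuousLinearMap.comp_apply, add_sub_cancel_right]
  have hFr'0 : Fr' 0 = ContinuousLinearMap.id ℝ V := by rw [hleft 0 (by linarith), hFr0]
  have hFr'T : ∀ a : V, Fr' T a = Cst (Fr T a) := fun a => by
    have h := hrel 0 ⟨by linarith, hη⟩ a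
    rw [zero_add, hFr'0] at h
    exact h
  have hR'O : ∀ x y, B (Cst (Fr T x)) (Cst (Fr T y)) = B x y := fun x y => by
    have h : H 0 (Cst (Fr T x)) (Cst (Fr T y)) = H 0 x y := by rw [hCstO, hRO0]
    rw [hH0, hH0] at h
    exact mul_left_cancel₀ hc.ne' h
  -- Step 6: `det R' > 0`, by continuity along `t ↦ Fr' t` on `[0, T]`
  have hIcc : Icc 0 T ⊆ (U ∩ Iio (T - 2 * η)) ∪ ((fun t : ℝ => t - T) ⁻¹' U ∩ Ioi (T - 3 * η)) :=
    fun t ht => hdom ⟨by linarith [ht.1], by linarith [ht.2]⟩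
  have hdet : 0 < (Cst.comp (Fr T)).det := by
    have hdetT : 0 < (Fr' T).det := by
      refine IndexOneForm.det_pos_of_continuousOn hT.le (hFr's.continuousOn.mono hIcc)
        (fun t ht x => hri' t (hIcc ht) x) ?_
      rw [hFr'0]
      unfold ContinuousLinearMap.det
      rw [show ((ContinuousLinearMap.id ℝ V : V →L[ℝ] V) : V →ₗ[ℝ] V) = LinearMap.id from rfl,
        LinearMap.det_id]
      exact one_pos
    have heq : Fr' T = Cst.comp (Fr T) := ContinuousLinearMap.ext hFr'T
    rwa [heq] at hdetT
  -- Step 7: `R'` preserves the timecones (the timelike field cannot switch cones along `[0, T]`)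
  have htimelike : ∀ t ∈ Icc 0 T, B (Fr' t (w t)) (Fr' t (w t)) < 0 := fun t ht => by
    have h : H t (w t) (w t) = c * B (Fr' t (w t)) (Fr' t (w t)) := by
      rw [had'' t (hIcc ht), hH0]
    have h' := hwneg' t
    rw [h] at h'
    exact neg_of_mul_neg_right h' hc.le
  have hψne : ∀ t ∈ Icc 0 T, B v₀ (Fr' t (w t)) ≠ 0 := fun t ht h => by
    have h' := htimelike t ht
    rw [IndexOneForm.apply_eq_of_frame hexp, h] at h'
    nlinarith [sq_nonneg (B b₁ (Fr' t (w t))), sq_nonneg (B b₂ (Fr' t (w t)))]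
  have hψc : ContinuousOn (fun t => B v₀ (Fr' t (w t))) (Icc 0 T) :=
    (B v₀).continuous.comp_continuousOn
      ((hFr's.continuousOn.mono hIcc).clm_apply hw.continuousOn)
  have hψpos : 0 < B v₀ (Fr' T (w T)) * B v₀ (Fr' 0 (w 0)) := by
    rcases lt_or_gt_of_ne (hψne 0 ⟨le_rfl, hT.le⟩) with h0 | h0 <;>
      rcases lt_or_gt_of_ne (hψne T ⟨hT.le, le_rfl⟩) with hT' | hT'
    · exact mul_pos_of_neg_of_neg hT' h0
    · exfalso
      obtain ⟨t, ht, hzero⟩ := intermediate_value_Icc hT.le hψc ⟨h0.le, hT'.le⟩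
      exact hψne t ht hzero
    · exfalso
      obtain ⟨t, ht, hzero⟩ := intermediate_value_Icc' hT.le hψc ⟨hT'.le, h0.le⟩
      exact hψne t ht hzero
    · exact mul_pos hT' h0
  have hcone : B (Cst (Fr T v₀)) v₀ < 0 := by
    have hx : B (w 0) (w 0) < 0 := by
      have h := htimelike 0 ⟨le_rfl, hT.le⟩
      rwa [hFr'0] at h
    have hw0 : w T = w 0 := by
      have h := hwT 0
      rwa [zero_add] at h
    have hRx : 0 < B v₀ (Cst (Fr T (w 0))) * B v₀ (w 0) := by
      have h := hψpos
      rw [hw0, hFr'T, hFr'0] at h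
      simpa using h
    exact neg_of_timeconePreserving (R := Cst.comp (Fr T)) hB hv hexp hR'O hx hRx
  -- Step 8: the path from `1` to `R'` inside `O(B)`
  obtain ⟨P, Pinv, hPs, hPinvs, hP0, hP1, hPPi, hPiP, hPO⟩ :=
    IndexOneForm.exists_smooth_path_of_timeconePreserving (R := Cst.comp (Fr T)) hB hv h1 h2 h01
      h02 h12 hexp hR'O hdet hcone
  have hPinvO : ∀ s x y, B (Pinv s x) (Pinv s y) = B x y := fun s x y => by
    rw [← hPO s (Pinv s x) (Pinv s y), hPPi, hPPi]
  have hPinv0 : ∀ s ≤ 0, ∀ x, Pinv s x = x := fun s hs x => by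
    have h := hPiP s x
    rwa [hP0 s hs] at h
  have hPinv1 : ∀ s, 1 ≤ s → ∀ x, Pinv s (Cst (Fr T x)) = x := fun s hs x => by
    have h := hPiP s x
    rwa [hP1 s hs] at h
  have hP1' : ∀ s, 1 ≤ s → ∀ x, P s x = Cst (Fr T x) := fun s hs x => by rw [hP1 s hs]; rfl
  -- Step 9: the corrected frame `Pinv (χ t) ∘ Fr' t`, `T`-periodic near `0`
  have hL : 0 < T - η := by linarith
  have hχs : ContDiff ℝ ∞ fun t : ℝ => (t - η / 2) / (T - η) :=
    (contDiff_id.sub contDiff_const).div_const _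
  have hχ0 : ∀ t, t ≤ η / 2 → (t - η / 2) / (T - η) ≤ 0 := fun t ht =>
    div_nonpos_of_nonpos_of_nonneg (by linarith) hL.le
  have hχ1 : ∀ t, T - η / 2 ≤ t → 1 ≤ (t - η / 2) / (T - η) := fun t ht => by
    rw [le_div_iff₀ hL]
    linarith
  have hper : ∀ s ∈ Ioo (-(η / 2)) (η / 2), ∀ a : V,
      Pinv ((s + T - η / 2) / (T - η)) (Fr' (s + T) a) = Pinv ((s - η / 2) / (T - η)) (Fr' s a) :=
    fun s hs a => by
      rw [hrel s ⟨by linarith [hs.1], by linarith [hs.2]⟩, hPinv1 _ (hχ1 _ (by linarith [hs.1])),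
        hPinv0 _ (hχ0 _ hs.2.le)]
  have hper' : ∀ s ∈ Ioo (-(η / 2)) (η / 2), ∀ a : V,
      Frinv' (s + T) (P ((s + T - η / 2) / (T - η)) a) = Frinv' s (P ((s - η / 2) / (T - η)) a) :=
    fun s hs a => by
      rw [hrel' s ⟨by linarith [hs.1], by linarith [hs.2]⟩, hP1' _ (hχ1 _ (by linarith [hs.1])),
        hP0 _ (hχ0 _ hs.2.le), hCC', hli T hTU]
      rfl
  have hO : IsOpen (Ioo (-η) (T + η)) := isOpen_Ioo
  have hF''s : ContDiffOn ℝ ∞ (fun t => (Pinv ((t - η / 2) / (T - η))).comp (Fr' t))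
      (Ioo (-η) (T + η)) :=
    (hPinvs.comp hχs).contDiffOn.clm_comp (hFr's.mono hdom)
  have hFinv''s : ContDiffOn ℝ ∞ (fun t => (Frinv' t).comp (P ((t - η / 2) / (T - η))))
      (Ioo (-η) (T + η)) :=
    (hFrinv's.mono hdom).clm_comp (hPs.comp hχs).contDiffOn
  have hsubδ : Ioo (-(η / 2)) (T + η / 2) ⊆ Ioo (-η) (T + η) := fun t ht =>
    ⟨by linarith [ht.1], by linarith [ht.2]⟩
  have hFps : ContDiff ℝ ∞ fun t =>
      (Pinv ((toIcoMod hT 0 t - η / 2) / (T - η))).comp (Fr' (toIcoMod hT 0 t)) :=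
    contDiff_comp_toIcoMod (F := fun t => (Pinv ((t - η / 2) / (T - η))).comp (Fr' t)) hT
      (by positivity) (by linarith) hO hsubδ hF''s fun s hs =>
        ContinuousLinearMap.ext fun a => by
          simpa only [ContinuousLinearMap.comp_apply, add_sub_assoc'] using hper s hs a
  have hFpinvs : ContDiff ℝ ∞ fun t =>
      (Frinv' (toIcoMod hT 0 t)).comp (P ((toIcoMod hT 0 t - η / 2) / (T - η))) :=
    contDiff_comp_toIcoMod (F := fun t => (Frinv' t).comp (P ((t - η / 2) / (T - η)))) hT
      (by positivity) (by linarith) hO hsubδ hFinv''s fun s hs =>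
        ContinuousLinearMap.ext fun a => by
          simpa only [ContinuousLinearMap.comp_apply, add_sub_assoc'] using hper' s hs a
  -- Step 10: conclusion
  have hmodU : ∀ t, toIcoMod hT 0 t ∈
      (U ∩ Iio (T - 2 * η)) ∪ ((fun t : ℝ => t - T) ⁻¹' U ∩ Ioi (T - 3 * η)) := fun t => by
    have h := toIcoMod_mem_Ico' hT t
    exact hIcc ⟨h.1, h.2.le⟩
  refine ⟨fun t => (Pinv ((toIcoMod hT 0 t - η / 2) / (T - η))).comp (Fr' (toIcoMod hT 0 t)),
    fun t => (Frinv' (toIcoMod hT 0 t)).comp (P ((toIcoMod hT 0 t - η / 2) / (T - η))),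
    hFps, hFpinvs, fun t => by simp only [toIcoMod_add_right], fun t => by
      simp only [toIcoMod_add_right], fun t a => ?_, fun t a => ?_, fun t a b => ?_⟩
  · show Pinv _ (Fr' _ (Frinv' _ (P _ a))) = a
    rw [hri' _ (hmodU t), hPiP]
  · show Frinv' _ (P _ (Pinv _ (Fr' _ a))) = a
    rw [hPPi, hli' _ (hmodU t)]
  · show fderiv ℝ (fderiv ℝ g) (t, 0) (0, a) (0, b) =
      c * B (Pinv _ (Fr' _ a)) (Pinv _ (Fr' _ b))
    rw [← hHap, hPinvO, ← hH0, ← hHmod t]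
    exact had'' _ (hmodU t) a b

end Splitting

end Literature.Topology.FourManifolds
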